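import Summits.BirchSwinnertonDyer.Rank1Residual.ManinAdditive.ConwayKodairaLaws
import HarnessLib

/-!
TYPER HEADER (bsd-f2-manin-ty g16, 2026-08-29; T-desc-21 OPTIONAL ask of desc g15 ADDENDUM 3, MEMO-desc §33.12) — one DEFINITION and
one typed THEOREM-CANDIDATE row, nothing asserted.

# The ramification of `ℚ₂(E[2])/ℚ₂`, and desc's T-desc-IV «Kodaira IV at 2 ⟺ `E[2]` unramified at 2» on the cell `v₂(N) = 2`

**The predicate** `IsTwoDivisionFieldUnramifiedAtTwo W`: the 2-division cubic `4x³ + b₂x² + 2b₄x + b₆` of `W` (Mathlib's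
`WeierstrassCurve.twoTorsionPolynomial`, whose roots are the `x`-coordinates of `E[2] ∖ 0`) SPLITS over `ℚ₂(ζ₆₃)`
(Mathlib: `CyclotomicField 63 ℚ_[2]`), the unramified extension of `ℚ₂` of degree `6`.  Why this is «`ℚ₂(E[2])/ℚ₂` is
unramified»: `ℚ₂(E[2])` is the splitting field of that cubic over `ℚ₂`, of degree dividing `6`; the unramified extension of
`ℚ₂` of degree `d` is `ℚ₂(ζ_{2^d − 1})`, and `2^d − 1 ∣ 63` for `d ∣ 6`, so `ℚ₂(E[2])/ℚ₂` is unramified iff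
`ℚ₂(E[2]) ⊆ ℚ₂(ζ₆₃)` iff the cubic splits there (Serre, *Corps locaux*, III §5 / Neukirch II §7: unramified extensions of `ℚ_p`
are generated by roots of unity of order prime to `p`).  The predicate is model-independent (the splitting field is) although
the cubic is not.  Mathlib-only constants; decidable in principle, not computed here.

**T-desc-IV** (desc g15, THEOREM-CANDIDATE, elementary — Tate's algorithm at `2`; census 235/235 optimal curves with `4 ∥ N`,
`N ≤ 1000`, engine `div2local.py` 5210dbf1083bb64a, tables DIV2LOCAL-1000-g15.txt 04056c88279e11d0): for `E/ℚ` with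
`v₂(N) = 2` the Kodaira symbol at `2` is IV iff `ℚ₂(E[2])/ℚ₂` is UNRAMIFIED (122/122) and IV* iff it is RAMIFIED (113/113).
desc's proof sketch (MEMO-desc §33.12): on a Tate-normalised minimal model, IV ⟺ `v₂(a₃) = 1` ⟹ with `x = 4y` the cubic becomes
monic integral with odd discriminant `Δ/16` ⟹ separable mod 2 ⟹ unramified; IV* ⟹ Newton polygon one segment of slope `8/3`
(`e = 3`) or `(3,3,2)` with `e` even.  Print status (desc): not located, presumably classical; typed here as an OBLIGATION
NODE `KodairaFourIffUnramifiedAtTwo` for -ref1 to probe and a prover to settle.  E-desc-105 (σ₂ ⟺ Serre weight) needs no new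
Prop (desc: = E-desc-38 reread via T-desc-IV).  HONEST FRAMING: nothing here bears on BSD or Manin beyond bookkeeping; C2 OPEN.
-/

noncomputable section

open WeierstrassCurve
open Summit.BirchSwinnertonDyer.Rank1Residual.ManinAdditive.ConwayCut (placeTwo)

namespace Summit.BirchSwinnertonDyer.Rank1Residual.ManinAdditive.TwoDivisionField

/-- **`ℚ₂(E[2])/ℚ₂` is unramified**: the 2-division cubic `4x³ + b₂x² + 2b₄x + b₆` of `W` splits over the unramified
sextic extension `ℚ₂(ζ₆₃)` of `ℚ₂` (equivalent to the unramifiedness of the splitting field `ℚ₂(E[2])`, whose degree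
divides `6`; see the module docstring). -/
def IsTwoDivisionFieldUnramifiedAtTwo (W : WeierstrassCurve ℚ) : Prop :=
  ((W.twoTorsionPolynomial.toPoly).map (algebraMap ℚ (CyclotomicField 63 ℚ_[2]))).Splits

/-- Unfolding. -/
theorem isTwoDivisionFieldUnramifiedAtTwo_iff (W : WeierstrassCurve ℚ) :
    IsTwoDivisionFieldUnramifiedAtTwo W ↔
      ((W.twoTorsionPolynomial.toPoly).map (algebraMap ℚ (CyclotomicField 63 ℚ_[2]))).Splits :=
  Iff.rfl

/-- **T-desc-IV `KodairaFourIffUnramifiedAtTwo`** (desc g15 ADDENDUM 3, MEMO-desc §33.12; THEOREM-CANDIDATE, elementary,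
census 235/235 at `4 ∥ N ≤ 1000`): for a globally minimal elliptic `W/ℚ` with `v₂(N) = 2`, the Kodaira symbol at `2` is
IV iff `ℚ₂(E[2])/ℚ₂` is unramified, and IV* iff it is ramified.  Why it might fail: only through a slip in the reading
«`v₂(N) = 2` ⟹ type IV or IV*» at `p = 2` (desc: 235/235; Ogg's formula) or in the predicate's sextic rendering (none expected).
TYPER FRAMING (T-desc-IV): lens desc; THEOREM-CANDIDATE (Tate's algorithm), obligation node until proved, nothing asserted.
[conjecture — cell candidate, NOT a tree fact] -/
@[conjecture] def KodairaFourIffUnramifiedAtTwo : Prop :=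
  ∀ (W : WeierstrassCurve ℚ) [W.IsElliptic] [W.IsGloballyMinimal], padicValNat 2 (W.conductorNorm ℤ) = 2 →
    (W.kodairaSymbolAt placeTwo = .IV ↔ IsTwoDivisionFieldUnramifiedAtTwo W) ∧
    (W.kodairaSymbolAt placeTwo = .IVstar ↔ ¬ IsTwoDivisionFieldUnramifiedAtTwo W)

/-- Bookkeeping edge: under T-desc-IV, on the cell `v₂(N) = 2` the types IV and IV* are complementary. -/
theorem kodaira_four_or_fourStar_of (h : KodairaFourIffUnramifiedAtTwo) (W : WeierstrassCurve ℚ) [W.IsElliptic]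
    [W.IsGloballyMinimal] (hN : padicValNat 2 (W.conductorNorm ℤ) = 2) :
    W.kodairaSymbolAt placeTwo = .IV ∨ W.kodairaSymbolAt placeTwo = .IVstar := by
  obtain ⟨h1, h2⟩ := h W hN
  by_cases hu : IsTwoDivisionFieldUnramifiedAtTwo W
  · exact Or.inl (h1.mpr hu)
  · exact Or.inr (h2.mpr hu)

end Summit.BirchSwinnertonDyer.Rank1Residual.ManinAdditive.TwoDivisionField

end
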